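import Summits.Langlands.Langlands.Statement
import Summits.Langlands.Langlands.Theorems.IrreducibilityBySelfDualityReciprocityUpToIrreducibilityHilbertSector
import HarnessLib

/-!
# Witness (F3 / BC5) for the rung `RegularTotallyRealA 3` of line `RegularTotallyRealA3`
# (crux `ReciprocityUpToIrreducibility`, item stmt-Langlands-14328)

The rung family `RegularTotallyRealA n` (VERBATIM the definition in `Lines/RegularTotallyRealA3.lean`)
SPECIALISES at `n = 2` to the tree's Hilbert-sector theorem
`Summit.Langlands.Langlands.Theorems.ReciprocityUpToIrreducibility.stub_hilbert_automorphicToGalois_of_pinned`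
(`Theorems/IrreducibilityBySelfDualityReciprocityUpToIrreducibilityHilbertSector.lean`: Carayol 1986,
Taylor 1989, Blasius–Rogawski 1993, Saito 2009, Skinner 2009 Thm 1), which is conditional on exactly the
three named Literature facts lang.S27 `exists_galoisRep_of_regularAlgebraic`,
`galoisRep_GL2_totallyReal_irreducible`, `galoisRep_GL2_totallyReal_localGlobal_pinned`; the example below
carries the same three facts as hypotheses and contains NO `sorry` (drop irreducibility and uniqueness
from the theorem's conclusion).
witness_regime: n = 2, K totally real, π cuspidal L-algebraic of regular infinity type (Hilbert modular
eigenforms of paritious weight ≥ 2); S known there: NO — the summit on that sector also asks direction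
(B) (modularity of EVERY irreducible geometric regular ρ : Γ_K → GL₂(ℚ̄_ℓ), open: only potential /
residually-large-image cases are theorems, Kisin 2009, BLGG 2013) and clause (A) for IRREGULAR π
(partial weight one: de Rham / local–global at p open in general); the floor is the (A)-half only, on the
regular sector, i.e. outside the regime where S is a theorem (S is a theorem only in rank 1).
-/

noncomputable section

set_option linter.dupNamespace false

open scoped MatrixGroups Matrix NumberField Classical Polynomial
open Filter IsDedekindDomain Field Polynomial
open Literature.NumberTheory.Automorphic Literature.NumberTheory.GaloisRepresentations
open Literature.NumberTheory.PAdicHodge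
open Summit.Langlands

namespace Summit.Langlands.Langlands.Cruxes.ReciprocityUpToIrreducibility.RegularTotallyRealA3.Special

/-- Rung family, verbatim `Lines/RegularTotallyRealA3.lean` `RegularTotallyRealA`. -/
def RegularTotallyRealA (n : ℕ) : Prop :=
  ∀ (K : Type) [Field K] [NumberField K], NumberField.IsTotallyReal K →
    ∃ Rec : ReciprocityData K,
      ∀ (hcpt : isCompact_glFiniteIntegralLevel n K) (π : CuspidalAutomorphicRepData n K hcpt),
        π.1.IsLAlgebraic → (∃ T : InfinityType K n, π.1.HasInfinityType T ∧ T.IsRegular) →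
        ∀ (ℓ : ℕ) [Fact ℓ.Prime] (ι : PadicAlgCl ℓ ≃+* ℂ),
          ∃ ρ : FramedGaloisRep K (PadicAlgCl ℓ) n, IsGeometricFramed Rec ρ ∧ Corresponds Rec ι π.1 ρ

/-- **The floor `n = 2` as a theorem of the family** (modulo the Hilbert theorem's three named facts). -/
theorem regularTotallyRealA_two_of_facts (h27 : exists_galoisRep_of_regularAlgebraic)
    (hirr : galoisRep_GL2_totallyReal_irreducible) (hLG : galoisRep_GL2_totallyReal_localGlobal_pinned) :
    RegularTotallyRealA 2 := by
  intro K _ _ hK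
  obtain ⟨Rec, h⟩ :=
    Summit.Langlands.Langlands.Theorems.ReciprocityUpToIrreducibility.stub_hilbert_automorphicToGalois_of_pinned
      h27 hirr hLG K hK
  refine ⟨Rec, fun hcpt π hL hreg ℓ _ ι => ?_⟩
  obtain ⟨ρ, -, hgeo, hcorr, -⟩ := h hcpt π hL hreg ℓ ι
  exact ⟨ρ, hgeo, hcorr⟩

/-- **F3 special-case instance**: the rung family at the floor parameter `n = 2` IS the floor. -/
example (h27 : exists_galoisRep_of_regularAlgebraic) (hirr : galoisRep_GL2_totallyReal_irreducible)
    (hLG : galoisRep_GL2_totallyReal_localGlobal_pinned) : RegularTotallyRealA 2 := by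
  simpa [RegularTotallyRealA] using regularTotallyRealA_two_of_facts h27 hirr hLG

end Summit.Langlands.Langlands.Cruxes.ReciprocityUpToIrreducibility.RegularTotallyRealA3.Special

end
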